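import Summits.KontsevichZagierPeriods.KontsevichZagierPeriods.Theorems.StuffleInKZ.Negative.IntegrandAdditivityGluing

/-!
# `StuffleInKZ` (stmt-3931), negative side, cycle 3 — rule (1b) is DERIVABLE from rules (1a) + (3):
# part 2, the band construction and the structure theorem

See part 1 (`IntegrandAdditivityGluing.lean`) for the construction. Results: `integrandAddRel ⊆
closure (domainAddRel ∪ newtonLeibnizRel)` (`integrandAddRel_subset_closure_domAdd_nl`),
`relations = closure (domainAddRel ∪ changeOfVariablesRel ∪ newtonLeibnizRel)`
(`relations_eq_closure_three_rules`), `covFreeRelations = closure (domainAddRel ∪ newtonLeibnizRel)`.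
Independence profile of the calculus (cdisprove unit of `StuffleInKZ`): (3) independent of (1)+(2)
(`NewtonLeibnizFree.lean`), (2) independent of (1)+(3) (`ChangeOfVariablesFree.lean`), (1b)
redundant given (1a)+(3) (this file); (1a) versus (1b)+(2)+(3): open. [folklore]
-/

noncomputable section

namespace Summit.KontsevichZagierPeriods.Theorems.StuffleInKZ.Negative

namespace Derived

open MeasureTheory Set Filter
open scoped Topology
open Literature.NumberTheory.Transcendental
open Literature.NumberTheory.Transcendental.KZ
open Literature.ModelTheory.ExponentialFields (IsSemialgebraic isSemialgebraic_univ
  isSemialgebraic_setOf_eval_pos isSemialgebraic_setOf_eval_eq_zero isSemialgebraic_setOf_eval_le)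
open MvPolynomial (aeval X C)

variable {n : ℕ}

/-! ### The hyperplane `{z_last = ½}` is null -/

/-- `{z | z_last = c}` has Lebesgue measure zero. [folklore] -/
theorem volume_last_eq (m : ℕ) (c : ℝ) : volume {z : Fin (m + 1) → ℝ | z (Fin.last m) = c} = 0 := by
  set e := MeasurableEquiv.piFinSuccAbove (fun _ : Fin (m + 1) => ℝ) (Fin.last m) with he
  have hmp : MeasurePreserving e volume volume := volume_preserving_piFinSuccAbove _ _
  have hset : {z : Fin (m + 1) → ℝ | z (Fin.last m) = c} = e ⁻¹' ({c} ×ˢ univ) := by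
    ext z
    simp [he, MeasurableEquiv.piFinSuccAbove_apply]
  rw [hset, hmp.measure_preimage ((measurableSet_singleton c).prod MeasurableSet.univ).nullMeasurableSet,
    Measure.volume_eq_prod, Measure.prod_prod, Real.volume_singleton, zero_mul]

/-! ### The band over `σ` and its two halves -/

section Band

variable (r r₁ r₂ : IntegralRep n)

/-- Blocks of a vector of `ℝⁿ⁺¹ = ℝⁿ × ℝ¹`: the first `n` coordinates are `Fin.init`. [folklore] -/
theorem block_init (z : Fin (n + 1) → ℝ) : (fun i : Fin n => z (Fin.castAdd 1 i)) = Fin.init z := rfl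

/-- … and the last block is the last coordinate. [folklore] -/
theorem block_last (z : Fin (n + 1) → ℝ) : (fun j : Fin 1 => z (Fin.natAdd n j)) = fun _ => z (Fin.last n) := by
  funext j
  have hj : j = 0 := Subsingleton.elim j 0
  subst hj
  rfl

/-- Membership in the lower half `r₁ × [[0,½]]`. [folklore] -/
theorem mem_bLo (z : Fin (n + 1) → ℝ) : z ∈ (r₁.prod segLo).domain ↔
    Fin.init z ∈ r₁.domain ∧ 0 ≤ z (Fin.last n) ∧ z (Fin.last n) ≤ 1 / 2 := by
  rw [IntegralRep.prod_domain, IntegralRep.mem_prodDomain, block_init, block_last]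
  simp only [segLo, segRep'_domain, mem_setOf_eq]
  norm_num

/-- Membership in the upper half `r₂ × [[½,1]]`. [folklore] -/
theorem mem_bHi (z : Fin (n + 1) → ℝ) : z ∈ (r₂.prod segHi).domain ↔
    Fin.init z ∈ r₂.domain ∧ 1 / 2 ≤ z (Fin.last n) ∧ z (Fin.last n) ≤ 1 := by
  rw [IntegralRep.prod_domain, IntegralRep.mem_prodDomain, block_init, block_last]
  simp only [segHi, segRep'_domain, mem_setOf_eq]
  norm_num

/-- The lower product integrand: `f₁(x) · 8(½ − t)`. [folklore] -/
theorem prodFun_lo (z : Fin (n + 1) → ℝ) :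
    IntegralRep.prodFun r₁ segLo z = r₁.integrand (Fin.init z) * (-8 * (z (Fin.last n) - 1 / 2)) := by
  rw [IntegralRep.prodFun_apply, block_init, block_last]
  simp only [segLo, segRep'_integrand]
  norm_num

/-- The upper product integrand: `f₂(x) · 8(t − ½)`. [folklore] -/
theorem prodFun_hi (z : Fin (n + 1) → ℝ) :
    IntegralRep.prodFun r₂ segHi z = r₂.integrand (Fin.init z) * (8 * (z (Fin.last n) - 1 / 2)) := by
  rw [IntegralRep.prodFun_apply, block_init, block_last]
  simp only [segHi, segRep'_integrand]
  norm_num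

open Classical in
/-- The glued integrand `G = f₁ ψ₁ + f₂ ψ₂` (piecewise of the two product integrands). -/
def G : (Fin (n + 1) → ℝ) → ℝ :=
  {z : Fin (n + 1) → ℝ | z (Fin.last n) ≤ 1 / 2}.piecewise (IntegralRep.prodFun r₁ segLo)
    (IntegralRep.prodFun r₂ segHi)

/-- `G = f₁ ψ₁ + f₂ ψ₂` pointwise. [folklore] -/
theorem G_eq (z : Fin (n + 1) → ℝ) : G r₁ r₂ z =
    r₁.integrand (Fin.init z) * ψ₁ (z (Fin.last n)) + r₂.integrand (Fin.init z) * ψ₂ (z (Fin.last n)) := by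
  classical
  unfold G
  by_cases hz : z (Fin.last n) ≤ 1 / 2
  · rw [piecewise_eq_of_mem _ _ _ (by exact hz), prodFun_lo, ψ₁_le hz, ψ₂_le hz]; ring
  · rw [piecewise_eq_of_notMem _ _ _ (by exact hz), prodFun_hi, ψ₁_gt (not_le.mp hz),
      ψ₂_gt (not_le.mp hz)]; ring

/-- The band `σ × [0,1]` (with `σ = r.domain`). -/
def B : Set (Fin (n + 1) → ℝ) :=
  {z | Fin.init z ∈ r.domain ∧ (0 : ℝ) ≤ z (Fin.last n) ∧ z (Fin.last n) ≤ 1}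

/-- The band is `ℚ`-semialgebraic. [folklore] -/
theorem isSemialgebraic_B : IsSemialgebraic ℚ (B r) := by
  have h0 : IsSemialgebraic ℚ {z : Fin (n + 1) → ℝ | aeval z (0 : MvPolynomial (Fin (n + 1)) ℚ) ≤
      aeval z (X (Fin.last n) : MvPolynomial (Fin (n + 1)) ℚ)} := isSemialgebraic_setOf_eval_le _ _
  have h1 : IsSemialgebraic ℚ {z : Fin (n + 1) → ℝ | aeval z (X (Fin.last n) : MvPolynomial (Fin (n + 1)) ℚ) ≤
      aeval z (1 : MvPolynomial (Fin (n + 1)) ℚ)} := isSemialgebraic_setOf_eval_le _ _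
  convert (r.isSemialgebraic_domain.setOf_init_mem.inter h0).inter h1 using 1
  ext z
  simp [B, and_assoc]

variable {r r₁ r₂}

/-- `B = (lower half) ∪ (upper half)`. [folklore] -/
theorem B_eq_union (h₁ : r₁.domain = r.domain) (h₂ : r₂.domain = r.domain) :
    B r = (r₁.prod segLo).domain ∪ (r₂.prod segHi).domain := by
  ext z
  rw [mem_union, mem_bLo, mem_bHi, h₁, h₂]
  simp only [B, mem_setOf_eq]
  constructor
  · rintro ⟨hσ, h0, h1⟩
    rcases le_or_gt (z (Fin.last n)) (1 / 2) with h | h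
    · exact Or.inl ⟨hσ, h0, h⟩
    · exact Or.inr ⟨hσ, h.le, h1⟩
  · rintro (⟨hσ, h0, h⟩ | ⟨hσ, h, h1⟩)
    · exact ⟨hσ, h0, by linarith⟩
    · exact ⟨hσ, by linarith, h1⟩

/-- The halves meet in a null set. [folklore] -/
theorem volume_inter_halves : volume ((r₁.prod segLo).domain ∩ (r₂.prod segHi).domain) = 0 := by
  refine measure_mono_null (fun z hz => ?_) (volume_last_eq n (1 / 2))
  have ha := (mem_bLo r₁ z).1 hz.1
  have hb := (mem_bHi r₂ z).1 hz.2
  show z (Fin.last n) = 1 / 2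
  linarith [ha.2.2, hb.2.1]

/-- `G` agrees with the lower product integrand on the lower half. [folklore] -/
theorem G_eqOn_lo : EqOn (G r₁ r₂) (r₁.prod segLo).integrand (r₁.prod segLo).domain := by
  intro z hz
  classical
  rw [IntegralRep.prod_integrand_eq, G, piecewise_eq_of_mem]
  exact ((mem_bLo r₁ z).1 hz).2.2

/-- `G` agrees with the upper product integrand on the upper half (both vanish at `t = ½`). -/
theorem G_eqOn_hi : EqOn (G r₁ r₂) (r₂.prod segHi).integrand (r₂.prod segHi).domain := by
  intro z hz
  have hz' := (mem_bHi r₂ z).1 hz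
  rw [IntegralRep.prod_integrand_eq, G_eq, prodFun_hi]
  rcases eq_or_lt_of_le hz'.2.1 with h | h
  · rw [← h, ψ₁_le le_rfl, ψ₂_le le_rfl]; ring
  · rw [ψ₁_gt h, ψ₂_gt h]; ring

/-- **The band representation** `[σ × [0,1], G]`. -/
def band (h₁ : r₁.domain = r.domain) (h₂ : r₂.domain = r.domain) : IntegralRep (n + 1) where
  domain := B r
  integrand := G r₁ r₂
  isSemialgebraic_domain := isSemialgebraic_B r
  isSemialgebraicFunOn_integrand := by
    have hA := isSemialgebraic_last_le_half n
    have hlo : IsSemialgebraicFunOn ℚ (B r ∩ {z | z (Fin.last n) ≤ 1 / 2}) (IntegralRep.prodFun r₁ segLo) := by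
      have h := (r₁.prod segLo).isSemialgebraicFunOn_integrand
      rw [IntegralRep.prod_integrand_eq] at h
      refine h.mono (fun z hz => ?_) ((isSemialgebraic_B r).inter hA)
      rw [mem_bLo, h₁]
      exact ⟨hz.1.1, hz.1.2.1, hz.2⟩
    have hhi : IsSemialgebraicFunOn ℚ (B r \ {z | z (Fin.last n) ≤ 1 / 2}) (IntegralRep.prodFun r₂ segHi) := by
      have h := (r₂.prod segHi).isSemialgebraicFunOn_integrand
      rw [IntegralRep.prod_integrand_eq] at h
      refine h.mono (fun z hz => ?_) ((isSemialgebraic_B r).diff hA)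
      rw [mem_bHi, h₂]
      have hgt : 1 / 2 < z (Fin.last n) := not_le.mp hz.2
      exact ⟨hz.1.1, hgt.le, hz.1.2.2⟩
    exact isSemialgebraicFunOn_piecewise hlo hhi
  integrableOn := by
    show IntegrableOn (G r₁ r₂) (B r)
    rw [B_eq_union h₁ h₂]
    refine IntegrableOn.union ?_ ?_
    · exact (r₁.prod segLo).integrableOn.congr_fun (G_eqOn_lo (r₁ := r₁) (r₂ := r₂)).symm
        (IntegralRep.measurableSet_domain_holds _)
    · exact (r₂.prod segHi).integrableOn.congr_fun (G_eqOn_hi (r₁ := r₁) (r₂ := r₂)).symm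
        (IntegralRep.measurableSet_domain_holds _)

/-- The primitive `F = f₁ Ψ₁ + f₂ Ψ₂` along the last coordinate. -/
def F (z : Fin (n + 1) → ℝ) : ℝ :=
  r₁.integrand (Fin.init z) * Ψ₁ (z (Fin.last n)) + r₂.integrand (Fin.init z) * Ψ₂ (z (Fin.last n))

/-- `F` is semialgebraic on the band. [folklore] -/
theorem isSemialgebraicFunOn_F (h₁ : r₁.domain = r.domain) (h₂ : r₂.domain = r.domain) :
    IsSemialgebraicFunOn ℚ (B r) (F (r₁ := r₁) (r₂ := r₂)) := by
  have hB := isSemialgebraic_B r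
  have hf1 : IsSemialgebraicFunOn ℚ (B r) (fun z => r₁.integrand (Fin.init z)) :=
    r₁.isSemialgebraicFunOn_integrand.comp_init.mono (fun z hz => by rw [mem_setOf_eq, h₁]; exact hz.1) hB
  have hf2 : IsSemialgebraicFunOn ℚ (B r) (fun z => r₂.integrand (Fin.init z)) :=
    r₂.isSemialgebraicFunOn_integrand.comp_init.mono (fun z hz => by rw [mem_setOf_eq, h₂]; exact hz.1) hB
  exact IsSemialgebraicFunOn.add_holds (IsSemialgebraicFunOn.mul_holds hf1 (isSemialgebraicFunOn_Ψ₁_last hB))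
    (IsSemialgebraicFunOn.mul_holds hf2 (isSemialgebraicFunOn_Ψ₂_last hB))

/-- A constant is semialgebraic. [folklore] -/
theorem isSemialgebraicFunOn_const' {m : ℕ} {s : Set (Fin m → ℝ)} (hs : IsSemialgebraic ℚ s) (q : ℚ) :
    IsSemialgebraicFunOn ℚ s (fun _ => (q : ℝ)) :=
  (isSemialgebraicFunOn_aeval hs (C q)).congr fun z _ => by simp

/-- **Move 1 (Newton–Leibniz on the whole band)**: `[band, G] − [σ, f₁ + f₂]`. -/
theorem move_band (h₁ : r₁.domain = r.domain) (h₂ : r₂.domain = r.domain)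
    (hadd : EqOn r.integrand (r₁.integrand + r₂.integrand) r.domain) :
    of (band h₁ h₂) - of r ∈ newtonLeibnizRel := by
  refine ⟨n, band h₁ h₂, r, fun _ => ((0 : ℚ) : ℝ), fun _ => ((1 : ℚ) : ℝ), F (r₁ := r₁) (r₂ := r₂),
    isSemialgebraicFunOn_F h₁ h₂, isSemialgebraicFunOn_const' r.isSemialgebraic_domain 0,
    isSemialgebraicFunOn_const' r.isSemialgebraic_domain 1, fun _ _ => by norm_num, ?_, ?_, ?_, ?_, rfl⟩
  · ext z
    simp [band, B]
  · intro x _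
    have e : (fun t : ℝ => F (r₁ := r₁) (r₂ := r₂) (Fin.snoc x t)) =
        fun t => r₁.integrand x * Ψ₁ t + r₂.integrand x * Ψ₂ t := by
      funext t; simp [F, Fin.init_snoc, Fin.snoc_last]
    rw [e]
    exact ((continuous_const.mul continuous_Ψ₁).add (continuous_const.mul continuous_Ψ₂)).continuousOn
  · intro x _ t _
    have e : (fun t : ℝ => F (r₁ := r₁) (r₂ := r₂) (Fin.snoc x t)) =
        fun t => r₁.integrand x * Ψ₁ t + r₂.integrand x * Ψ₂ t := by
      funext t; simp [F, Fin.init_snoc, Fin.snoc_last]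
    have e' : (band h₁ h₂).integrand (Fin.snoc x t) = r₁.integrand x * ψ₁ t + r₂.integrand x * ψ₂ t := by
      show G r₁ r₂ (Fin.snoc x t) = _
      rw [G_eq]; simp [Fin.init_snoc, Fin.snoc_last]
    rw [e, e']
    exact ((hasDerivAt_Ψ₁ t).const_mul _).add ((hasDerivAt_Ψ₂ t).const_mul _)
  · intro x hx
    rw [hadd hx]
    simp only [F, Fin.init_snoc, Fin.snoc_last, Pi.add_apply, Rat.cast_zero, Rat.cast_one]
    rw [Ψ₁_gt (by norm_num : (1 : ℝ) / 2 < 1), Ψ₂_gt (by norm_num : (1 : ℝ) / 2 < 1),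
      Ψ₁_le (by norm_num : (0 : ℝ) ≤ 1 / 2), Ψ₂_le (by norm_num : (0 : ℝ) ≤ 1 / 2)]
    norm_num

/-- **Move 2 (domain additivity)**: cut the band at `t = ½`. -/
theorem move_cut (h₁ : r₁.domain = r.domain) (h₂ : r₂.domain = r.domain) :
    of (band h₁ h₂) - of (r₁.prod segLo) - of (r₂.prod segHi) ∈ domainAddRel :=
  ⟨n + 1, band h₁ h₂, r₁.prod segLo, r₂.prod segHi, B_eq_union h₁ h₂, volume_inter_halves,
    G_eqOn_lo, G_eqOn_hi, rfl⟩

/-- **Move 3 (Newton–Leibniz on the lower half)**: `[r₁ × [0,½], f₁ · 8(½−t)] − [σ, f₁]`. -/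
theorem move_lo : of (r₁.prod segLo) - of r₁ ∈ newtonLeibnizRel := by
  refine ⟨n, r₁.prod segLo, r₁, fun _ => ((0 : ℚ) : ℝ), fun _ => (((1 / 2 : ℚ)) : ℝ),
    fun z => r₁.integrand (Fin.init z) * (4 * z (Fin.last n) - 4 * z (Fin.last n) ^ 2),
    ?_, isSemialgebraicFunOn_const' r₁.isSemialgebraic_domain 0,
    isSemialgebraicFunOn_const' r₁.isSemialgebraic_domain (1 / 2), fun _ _ => by norm_num, ?_, ?_, ?_, ?_, rfl⟩
  · have hD := (r₁.prod segLo).isSemialgebraic_domain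
    have hf1 : IsSemialgebraicFunOn ℚ (r₁.prod segLo).domain (fun z => r₁.integrand (Fin.init z)) :=
      r₁.isSemialgebraicFunOn_integrand.comp_init.mono (fun z hz => ((mem_bLo r₁ z).1 hz).1) hD
    have hp : IsSemialgebraicFunOn ℚ (r₁.prod segLo).domain
        (fun z => 4 * z (Fin.last n) - 4 * z (Fin.last n) ^ 2) :=
      (isSemialgebraicFunOn_aeval hD (C (4 : ℚ) * X (Fin.last n) - C (4 : ℚ) * X (Fin.last n) ^ 2)).congr
        fun z _ => by simp
    exact IsSemialgebraicFunOn.mul_holds hf1 hp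
  · ext z
    rw [mem_bLo]
    simp only [mem_setOf_eq]
    norm_num
  · intro x _
    simp only [Fin.init_snoc, Fin.snoc_last]
    exact Continuous.continuousOn (by fun_prop)
  · intro x _ t _
    rw [IntegralRep.prod_integrand_eq, prodFun_lo]
    simp only [Fin.init_snoc, Fin.snoc_last]
    exact (hasDerivAt_pLo t).const_mul _
  · intro x _
    simp only [Fin.init_snoc, Fin.snoc_last]
    norm_num

/-- **Move 4 (Newton–Leibniz on the upper half)**: `[r₂ × [½,1], f₂ · 8(t−½)] − [σ, f₂]`. -/
theorem move_hi : of (r₂.prod segHi) - of r₂ ∈ newtonLeibnizRel := by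
  refine ⟨n, r₂.prod segHi, r₂, fun _ => (((1 / 2 : ℚ)) : ℝ), fun _ => ((1 : ℚ) : ℝ),
    fun z => r₂.integrand (Fin.init z) * (4 * (z (Fin.last n) - 1 / 2) ^ 2),
    ?_, isSemialgebraicFunOn_const' r₂.isSemialgebraic_domain (1 / 2),
    isSemialgebraicFunOn_const' r₂.isSemialgebraic_domain 1, fun _ _ => by norm_num, ?_, ?_, ?_, ?_, rfl⟩
  · have hD := (r₂.prod segHi).isSemialgebraic_domain
    have hf2 : IsSemialgebraicFunOn ℚ (r₂.prod segHi).domain (fun z => r₂.integrand (Fin.init z)) :=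
      r₂.isSemialgebraicFunOn_integrand.comp_init.mono (fun z hz => ((mem_bHi r₂ z).1 hz).1) hD
    have hp : IsSemialgebraicFunOn ℚ (r₂.prod segHi).domain
        (fun z => 4 * (z (Fin.last n) - 1 / 2) ^ 2) :=
      (isSemialgebraicFunOn_aeval hD (C (4 : ℚ) * (X (Fin.last n) - C (1 / 2 : ℚ)) ^ 2)).congr
        fun z _ => by simp
    exact IsSemialgebraicFunOn.mul_holds hf2 hp
  · ext z
    rw [mem_bHi]
    simp only [mem_setOf_eq]
    norm_num
  · intro x _
    simp only [Fin.init_snoc, Fin.snoc_last]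
    exact Continuous.continuousOn (by fun_prop)
  · intro x _ t _
    rw [IntegralRep.prod_integrand_eq, prodFun_hi]
    simp only [Fin.init_snoc, Fin.snoc_last]
    exact (hasDerivAt_pHi t).const_mul _
  · intro x _
    simp only [Fin.init_snoc, Fin.snoc_last]
    norm_num

/-- **`[σ, f₁+f₂] − [σ, f₁] − [σ, f₂]` is generated by domain additivity and Newton–Leibniz.** -/
theorem of_sub_of_sub_of_mem_closure (h₁ : r₁.domain = r.domain) (h₂ : r₂.domain = r.domain)
    (hadd : EqOn r.integrand (r₁.integrand + r₂.integrand) r.domain) :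
    of r - of r₁ - of r₂ ∈ AddSubgroup.closure (domainAddRel ∪ newtonLeibnizRel) := by
  have e : of r - of r₁ - of r₂ =
      -(of (band h₁ h₂) - of r) + (of (band h₁ h₂) - of (r₁.prod segLo) - of (r₂.prod segHi)) +
        (of (r₁.prod segLo) - of r₁) + (of (r₂.prod segHi) - of r₂) := by abel
  rw [e]
  refine AddSubgroup.add_mem _ (AddSubgroup.add_mem _ (AddSubgroup.add_mem _
    (AddSubgroup.neg_mem _ (AddSubgroup.subset_closure (Or.inr (move_band h₁ h₂ hadd))))
    (AddSubgroup.subset_closure (Or.inl (move_cut h₁ h₂))))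
    (AddSubgroup.subset_closure (Or.inr move_lo)))
    (AddSubgroup.subset_closure (Or.inr move_hi))

end Band

/-! ### Rule (1b) is derivable; the calculus has three rules -/

/-- **Integrand additivity is derivable from domain additivity and Newton–Leibniz.** -/
theorem integrandAddRel_subset_closure_domAdd_nl :
    integrandAddRel ⊆ (AddSubgroup.closure (domainAddRel ∪ newtonLeibnizRel) : Set FormalRep) := by
  rintro c ⟨k, r, r₁, r₂, h₁, h₂, hadd, rfl⟩
  exact of_sub_of_sub_of_mem_closure h₁ h₂ hadd

/-- **Three rules suffice**: `relations = closure (domainAddRel ∪ changeOfVariablesRel ∪ newtonLeibnizRel)`. -/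
theorem relations_eq_closure_three_rules :
    relations = AddSubgroup.closure (domainAddRel ∪ changeOfVariablesRel ∪ newtonLeibnizRel) := by
  apply le_antisymm
  · refine (AddSubgroup.closure_le _).mpr ?_
    rintro c (((hc | hc) | hc) | hc)
    · exact AddSubgroup.subset_closure (Or.inl (Or.inl hc))
    · exact AddSubgroup.closure_mono (fun x hx => hx.elim (fun h => Or.inl (Or.inl h)) Or.inr)
        (integrandAddRel_subset_closure_domAdd_nl hc)
    · exact AddSubgroup.subset_closure (Or.inl (Or.inr hc))
    · exact AddSubgroup.subset_closure (Or.inr hc)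
  · exact AddSubgroup.closure_mono fun c hc => hc.elim (fun h => h.elim (fun h' => Or.inl (Or.inl (Or.inl h')))
      (fun h' => Or.inl (Or.inr h'))) Or.inr

/-- The CoV-free sub-calculus needs only (1a) + (3). -/
theorem covFreeRelations_eq_closure_domAdd_nl :
    covFreeRelations = AddSubgroup.closure (domainAddRel ∪ newtonLeibnizRel) := by
  apply le_antisymm
  · refine (AddSubgroup.closure_le _).mpr ?_
    rintro c ((hc | hc) | hc)
    · exact AddSubgroup.subset_closure (Or.inl hc)
    · exact integrandAddRel_subset_closure_domAdd_nl hc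
    · exact AddSubgroup.subset_closure (Or.inr hc)
  · exact AddSubgroup.closure_mono fun c hc => hc.elim (fun h => Or.inl (Or.inl h)) Or.inr

end Derived

end Summit.KontsevichZagierPeriods.Theorems.StuffleInKZ.Negative
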